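import Mathlib.Topology.Covering.Basic
import Mathlib.Topology.Homotopy.Lifting
import Mathlib.Topology.LocallyConstant.Basic
import Mathlib.Topology.Connected.LocallyConnected
import HarnessLib

/-!
# Analytic continuation on a simply connected space: the monodromy theorem for a sheaf of
# functions with unique continuation and local extension

Topic `Topology/CoveringSpaces`. The classical "analytic continuation along curves +
simple connectivity" argument — Kobayashi–Nomizu, *Foundations of Differential Geometry* I (1963),
Ch. VI, §6, proof of Thm. 6.1 (continuation of affine/isometric maps: Lemma 4 (uniqueness from a
germ), existence of a continuation along every curve from a LOCAL EXTENSION property on good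
neighbourhoods, independence of the curve by the factorization lemma of Appendix 7 on a simply
connected manifold), which is also the scheme of Nomizu's theorem on the extension of Killing vector
fields of analytic metrics (Ann. of Math. 72 (1960), Thm. 2) — abstracted to a **sheaf of
functions** `M → V` given by a predicate `K U f` ("`f` is a good section over the open set `U`"):

* **`exists_extension_of_simplyConnected`**: suppose `K` restricts to open subsets (`hK_mono`), is
  local (`hK_local`), has **unique continuation** (two sections over a preconnected open set which
  agree near one of its points agree on it, `hK_uniq`) and the **local extension property** (every
  point has a preconnected open neighbourhood `W` such that every germ of a section at a point of
  `W` is the germ of a section over `W`, `hK_ext`). If `M` is simply connected and locally path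
  connected, then every section over a connected open set `O` is the restriction of a global section.

The proof is the sheaf-theoretic form of the printed one, letting Mathlib's covering-space theory
do the continuation along paths: the germs of sections form an étalé space `Γ → M` (sheets of local
sections as basic open sets); unique continuation and local extension make it a covering map over
each `W` (fibre: the sections over `W`, discrete); since `M` is simply connected and locally path
connected the identity of `M` lifts to a continuous section of `Γ` through the germ of the given
section at a point of `O` (Mathlib's `IsCoveringMap.existsUnique_continuousMap_lifts`, the
monodromy theorem); evaluating germs gives the global section, which is good by locality and agrees
with the given one on `O` by connectedness of `O` and unique continuation. The construction is
internal to the proof (compare `Literature/Geometry/Manifold/GStructureDevelopment.lean`, the same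
device for developing maps of `(X, G)`-structures). No definitions, no named facts.

## References

* S. Kobayashi, K. Nomizu, *Foundations of Differential Geometry* I, Interscience 1963, Ch. VI §6,
  Thm. 6.1 with Lemmas 1–4, and Appendix 7. [KobayashiNomizu1963]
* K. Nomizu, *On local and global existence of Killing vector fields*, Ann. of Math. (2) 72 (1960)
  105–120, Thm. 2. [Nomizu1960]
-/

noncomputable section

open Set Function Filter Topology

namespace Literature.Topology.CoveringSpaces

universe u v

/-- **Monodromy theorem for a sheaf of functions with unique continuation and local extension**
(the continuation argument of Kobayashi–Nomizu I, Ch. VI, proof of Thm. 6.1, and Appendix 7, in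
sheaf-theoretic form). Let `K U f` be a property of functions `f : M → V` on open sets `U ⊆ M` which
restricts to open subsets (`hK_mono`), is local (`hK_local`: a function which near every point
agrees with a `K`-section is a global `K`-section), has unique continuation on preconnected open
sets (`hK_uniq`) and the local extension property (`hK_ext`: every point has an open preconnected
neighbourhood `W` over which every germ of a `K`-section at a point of `W` extends). If `M` is simply
connected and locally path connected, `O ⊆ M` is open and connected and `f₀` is a `K`-section over
`O`, then there is a global `K`-section `F` with `F = f₀` on `O`.
[cite: KobayashiNomizu1963, Ch. VI §6, proof of Thm. 6.1, and Appendix 7] -/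
theorem exists_extension_of_simplyConnected
    {M : Type u} [TopologicalSpace M] [SimplyConnectedSpace M] [LocallyPathConnectedSpace M]
    {V : Type v} (K : Set M → (M → V) → Prop)
    (hK_mono : ∀ ⦃U U' : Set M⦄ ⦃f : M → V⦄, K U f → IsOpen U' → U' ⊆ U → K U' f)
    (hK_uniq : ∀ ⦃U : Set M⦄ ⦃f f' : M → V⦄, IsOpen U → IsPreconnected U → K U f → K U f' →
      ∀ ⦃x : M⦄, x ∈ U → f =ᶠ[𝓝 x] f' → EqOn f f' U)
    (hK_ext : ∀ x₀ : M, ∃ W : Set M, IsOpen W ∧ x₀ ∈ W ∧ IsPreconnected W ∧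
      ∀ y ∈ W, ∀ (U : Set M) (f : M → V), IsOpen U → y ∈ U → K U f →
        ∃ f' : M → V, K W f' ∧ f =ᶠ[𝓝 y] f')
    (hK_local : ∀ F : M → V,
      (∀ x : M, ∃ U : Set M, IsOpen U ∧ x ∈ U ∧ ∃ f : M → V, K U f ∧ EqOn F f U) → K univ F)
    {O : Set M} (hO : IsOpen O) (hOc : IsConnected O) {f₀ : M → V} (hf₀ : K O f₀) :
    ∃ F : M → V, K univ F ∧ EqOn F f₀ O := by
  classical
  /- ### germs of `K`-sections -/
  -- representatives: pairs `(x, f)` with `f` a `K`-section on some open set containing `x`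
  let PG : Type (max u v) := {p : M × (M → V) // ∃ U : Set M, IsOpen U ∧ p.1 ∈ U ∧ K U p.2}
  let rel : PG → PG → Prop := fun p q ↦ p.1.1 = q.1.1 ∧ p.1.2 =ᶠ[𝓝 p.1.1] q.1.2
  have rel_equiv : Equivalence rel := by
    refine ⟨fun p ↦ ⟨rfl, EventuallyEq.rfl⟩, ?_, ?_⟩
    · rintro p q ⟨h1, h2⟩
      refine ⟨h1.symm, ?_⟩
      rw [← h1]
      exact h2.symm
    · rintro p q r ⟨h1, h2⟩ ⟨h1', h2'⟩
      refine ⟨h1.trans h1', ?_⟩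
      rw [← h1] at h2'
      exact h2.trans h2'
  let sR : Setoid PG := ⟨rel, rel_equiv⟩
  let Γ : Type (max u v) := Quotient sR
  -- the germ of `f` at `x`
  let mk : ∀ (x : M) (f : M → V), (∃ U : Set M, IsOpen U ∧ x ∈ U ∧ K U f) → Γ :=
    fun x f h ↦ Quotient.mk sR ⟨(x, f), h⟩
  have mk_eq_mk_iff : ∀ {x y : M} {f g : M → V} {hx : ∃ U : Set M, IsOpen U ∧ x ∈ U ∧ K U f}
      {hy : ∃ U : Set M, IsOpen U ∧ y ∈ U ∧ K U g},
      mk x f hx = mk y g hy ↔ x = y ∧ f =ᶠ[𝓝 x] g := fun {x y f g hx hy} ↦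
    Quotient.eq (r := sR)
  have mk_surj : ∀ e : Γ, ∃ (x : M) (f : M → V) (h : ∃ U : Set M, IsOpen U ∧ x ∈ U ∧ K U f),
      e = mk x f h := by
    intro e
    induction e using Quotient.ind with
    | _ p => exact ⟨p.1.1, p.1.2, p.2, rfl⟩
  -- the base point
  let pt : Γ → M := Quotient.lift (s := sR) (fun p : PG ↦ p.1.1) fun _ _ h ↦ h.1
  have pt_mk : ∀ (x : M) (f : M → V) (h : ∃ U : Set M, IsOpen U ∧ x ∈ U ∧ K U f),
      pt (mk x f h) = x := fun _ _ _ ↦ rfl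
  /- ### the étalé topology -/
  -- the sheet of a local section `f` (a `K`-section on the open set `U`) over `S ⊆ M`
  let sheet : ∀ (U : Set M) (f : M → V), IsOpen U → K U f → Set M → Set Γ :=
    fun U f hU hf S ↦ {e | ∃ (y : M) (hy : y ∈ U), y ∈ S ∧ e = mk y f ⟨U, hU, hy, hf⟩}
  letI tΓ : TopologicalSpace Γ := TopologicalSpace.generateFrom
    {s | ∃ (U : Set M) (f : M → V) (hU : IsOpen U) (hf : K U f) (S : Set M),
      IsOpen S ∧ s = sheet U f hU hf S}
  have mk_mem_sheet_iff : ∀ {y : M} {g : M → V} {hy : ∃ U : Set M, IsOpen U ∧ y ∈ U ∧ K U g}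
      (U : Set M) (f : M → V) (hU : IsOpen U) (hf : K U f) (S : Set M),
      mk y g hy ∈ sheet U f hU hf S ↔ y ∈ U ∧ y ∈ S ∧ g =ᶠ[𝓝 y] f := by
    intro y g hy U f hU hf S
    constructor
    · rintro ⟨y', hy', hyS, he⟩
      obtain ⟨rfl, he'⟩ := mk_eq_mk_iff.mp he
      exact ⟨hy', hyS, he'⟩
    · rintro ⟨hyU, hyS, he⟩
      exact ⟨y, hyU, hyS, mk_eq_mk_iff.mpr ⟨rfl, he⟩⟩
  have isOpen_sheet : ∀ (U : Set M) (f : M → V) (hU : IsOpen U) (hf : K U f) {S : Set M},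
      IsOpen S → IsOpen (sheet U f hU hf S) := fun U f hU hf S hS ↦
    TopologicalSpace.isOpen_generateFrom_of_mem ⟨U, f, hU, hf, S, hS, rfl⟩
  have pt_mem_of_mem_sheet : ∀ (U : Set M) (f : M → V) (hU : IsOpen U) (hf : K U f) (S : Set M)
      (e : Γ), e ∈ sheet U f hU hf S → pt e ∈ S := by
    rintro U f hU hf S e ⟨y, hy, hyS, rfl⟩
    exact hyS
  have continuous_pt : Continuous pt := by
    refine continuous_def.mpr fun S hS ↦ ?_
    have hunion : pt ⁻¹' S = ⋃ (U : Set M) (f : M → V) (hU : IsOpen U) (hf : K U f),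
        sheet U f hU hf S := by
      ext e
      obtain ⟨x, f, ⟨U, hU, hx, hf⟩, rfl⟩ := mk_surj e
      simp only [mem_preimage, pt_mk, mem_iUnion]
      constructor
      · intro hxS
        exact ⟨U, f, hU, hf, x, hx, hxS, rfl⟩
      · rintro ⟨U', f', hU', hf', he⟩
        exact pt_mem_of_mem_sheet U' f' hU' hf' S _ he
    rw [hunion]
    exact isOpen_iUnion fun U ↦ isOpen_iUnion fun f ↦ isOpen_iUnion fun hU ↦
      isOpen_iUnion fun hf ↦ isOpen_sheet U f hU hf hS
  -- the sheet parametrisation over `U` is continuous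
  have continuous_mk : ∀ (U : Set M) (f : M → V) (hU : IsOpen U) (hf : K U f),
      Continuous fun y : U ↦ mk (y : M) f ⟨U, hU, y.2, hf⟩ := by
    intro U f hU hf
    refine continuous_generateFrom_iff.mpr ?_
    rintro s ⟨U', f', hU', hf', S, hS, rfl⟩
    have : (fun y : U ↦ mk (y : M) f ⟨U, hU, y.2, hf⟩) ⁻¹' sheet U' f' hU' hf' S =
        Subtype.val ⁻¹' (U' ∩ S ∩ {y | f =ᶠ[𝓝 y] f'}) := by
      ext y
      simp only [mem_preimage, mk_mem_sheet_iff, mem_inter_iff, mem_setOf_eq]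
      tauto
    rw [this]
    refine IsOpen.preimage continuous_subtype_val ((hU'.inter hS).inter ?_)
    exact isOpen_setOf_eventually_nhds (p := fun z ↦ f z = f' z)
  /- ### the germ space is a covering space -/
  choose W hWo hWx hWc hWext using hK_ext
  have hcov : IsCoveringMap pt := by
    intro x₀
    -- over `W x₀`, every germ is the germ of a `K`-section on `W x₀`
    have hrep : ∀ e : pt ⁻¹' W x₀, ∃ g : M → V, ∃ hg : K (W x₀) g,
        (e : Γ) = mk (pt e) g ⟨W x₀, hWo x₀, e.2, hg⟩ := by
      rintro ⟨e, he⟩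
      obtain ⟨x, f, ⟨U, hU, hx, hf⟩, rfl⟩ := mk_surj e
      obtain ⟨g, hg, hfg⟩ := hWext x₀ x he U f hU hx hf
      exact ⟨g, hg, mk_eq_mk_iff.mpr ⟨rfl, hfg⟩⟩
    choose σ hσK hσ using hrep
    -- ... and that section is unique on `W x₀`
    have huniqW : ∀ {y : M} (hy : y ∈ W x₀) {g₁ g₂ : M → V} (h₁ : K (W x₀) g₁) (h₂ : K (W x₀) g₂),
        mk y g₁ ⟨W x₀, hWo x₀, hy, h₁⟩ = mk y g₂ ⟨W x₀, hWo x₀, hy, h₂⟩ → EqOn g₁ g₂ (W x₀) := by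
      intro y hy g₁ g₂ h₁ h₂ heq
      obtain ⟨-, hev⟩ := mk_eq_mk_iff.mp heq
      exact hK_uniq (hWo x₀) (hWc x₀) h₁ h₂ hy hev
    -- the fibre: restrictions to `W x₀` of `K`-sections on `W x₀`, discrete
    let Fib : Type (max u v) :=
      {h : W x₀ → V // ∃ g : M → V, K (W x₀) g ∧ ∀ y, h y = g y}
    letI : TopologicalSpace Fib := ⊥
    haveI : DiscreteTopology Fib := ⟨rfl⟩
    -- the fibre coordinate of a germ over `W x₀`
    let τ : pt ⁻¹' W x₀ → Fib := fun e ↦ ⟨fun y ↦ σ e y, σ e, hσK e, fun _ ↦ rfl⟩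
    have hτ_loc : IsLocallyConstant τ := by
      refine (IsLocallyConstant.iff_eventually_eq _).mpr fun e₀ ↦ ?_
      have hopen : IsOpen (Subtype.val ⁻¹' sheet (W x₀) (σ e₀) (hWo x₀) (hσK e₀) (W x₀) :
          Set (pt ⁻¹' W x₀)) :=
        (isOpen_sheet (W x₀) (σ e₀) (hWo x₀) (hσK e₀) (hWo x₀)).preimage continuous_subtype_val
      have hmem : e₀ ∈ (Subtype.val ⁻¹' sheet (W x₀) (σ e₀) (hWo x₀) (hσK e₀) (W x₀) :
          Set (pt ⁻¹' W x₀)) := by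
        rw [mem_preimage, hσ e₀]
        exact ⟨pt e₀, e₀.2, e₀.2, rfl⟩
      filter_upwards [hopen.mem_nhds hmem] with e he
      obtain ⟨y, hy, -, hey⟩ := he
      have hpt : pt (e : Γ) = y := by rw [hey, pt_mk]
      -- `σ e` and `σ e₀` define the same germ at `y = pt e`, hence agree on `W x₀`
      have h1 : mk y (σ e) ⟨W x₀, hWo x₀, hy, hσK e⟩ = mk y (σ e₀) ⟨W x₀, hWo x₀, hy, hσK e₀⟩ := by
        have h3 : mk (pt (e : Γ)) (σ e) ⟨W x₀, hWo x₀, e.2, hσK e⟩ =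
            mk y (σ e) ⟨W x₀, hWo x₀, hy, hσK e⟩ := mk_eq_mk_iff.mpr ⟨hpt, EventuallyEq.rfl⟩
        exact h3.symm.trans ((hσ e).symm.trans hey)
      have hEq : EqOn (σ e) (σ e₀) (W x₀) := huniqW hy (hσK e) (hσK e₀) h1
      apply Subtype.ext
      funext z
      exact hEq z.2
    -- the local trivialisation `pt ⁻¹' (W x₀) ≃ₜ W x₀ × Fib`
    let toF : pt ⁻¹' W x₀ → W x₀ × Fib := fun e ↦ (⟨pt e, e.2⟩, τ e)
    let invF : W x₀ × Fib → pt ⁻¹' W x₀ := fun p ↦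
      ⟨mk (p.1 : M) p.2.2.choose ⟨W x₀, hWo x₀, p.1.2, p.2.2.choose_spec.1⟩, by
        show pt _ ∈ W x₀
        rw [pt_mk]
        exact p.1.2⟩
    have left : LeftInverse invF toF := by
      intro e
      apply Subtype.ext
      show mk (pt (e : Γ)) (τ e).2.choose _ = (e : Γ)
      refine (mk_eq_mk_iff.mpr ⟨rfl, ?_⟩).trans (hσ e).symm
      -- `(τ e).2.choose` and `σ e` are `K`-sections on `W x₀` with the same restriction
      have hc := (τ e).2.choose_spec
      have hEq : EqOn (τ e).2.choose (σ e) (W x₀) := fun z hz ↦ (hc.2 ⟨z, hz⟩).symm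
      exact Filter.eventuallyEq_of_mem ((hWo x₀).mem_nhds e.2) hEq
    have right : RightInverse invF toF := by
      rintro ⟨⟨y, hy⟩, h⟩
      have hc := h.2.choose_spec
      -- the section chosen for the germ `mk y h.choose` agrees with `h.choose` on `W x₀`
      set e : pt ⁻¹' W x₀ := invF (⟨y, hy⟩, h) with he
      have hpt : pt (e : Γ) = y := pt_mk _ _ _
      have h1 : mk y (σ e) ⟨W x₀, hWo x₀, hy, hσK e⟩ = mk y h.2.choose ⟨W x₀, hWo x₀, hy, hc.1⟩ := by
        have h2 := hσ e   -- (e : Γ) = mk (pt e) (σ e) _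
        have h3 : mk (pt (e : Γ)) (σ e) ⟨W x₀, hWo x₀, e.2, hσK e⟩ =
            mk y (σ e) ⟨W x₀, hWo x₀, hy, hσK e⟩ := mk_eq_mk_iff.mpr ⟨hpt, EventuallyEq.rfl⟩
        exact h3.symm.trans h2.symm
      have hEq : EqOn (σ e) h.2.choose (W x₀) := huniqW hy (hσK e) hc.1 h1
      ext
      · exact hpt
      · show σ e _ = h.1 _
        rw [hc.2]
        exact hEq (Subtype.mem _)
    have hcont : Continuous toF :=
      ((continuous_pt.comp continuous_subtype_val).subtype_mk _).prodMk hτ_loc.continuous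
    have hcont' : Continuous invF := by
      refine continuous_prod_of_discrete_right.mpr fun h ↦ ?_
      exact ((continuous_mk (W x₀) h.2.choose (hWo x₀) h.2.choose_spec.1).subtype_mk _)
    have hev : IsEvenlyCovered pt x₀ Fib :=
      ⟨inferInstance, W x₀, hWx x₀, hWo x₀, (hWo x₀).preimage continuous_pt,
        { toFun := toF, invFun := invF, left_inv := left, right_inv := right,
          continuous_toFun := hcont, continuous_invFun := hcont' }, fun e ↦ rfl⟩
    exact hev.to_isEvenlyCovered_preimage
  /- ### the global section through the germ of `f₀` -/
  obtain ⟨x₀, hx₀⟩ := hOc.nonempty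
  obtain ⟨Fg, ⟨hF₀, hF⟩, -⟩ := hcov.existsUnique_continuousMap_lifts (ContinuousMap.id M) x₀
    (mk x₀ f₀ ⟨O, hO, hx₀, hf₀⟩) rfl
  have hFpt : ∀ x, pt (Fg x) = x := fun x ↦ congrFun hF x
  -- representatives of the values of the section
  have hrepF : ∀ x : M, ∃ (g : M → V) (hg : ∃ U : Set M, IsOpen U ∧ x ∈ U ∧ K U g),
      Fg x = mk x g hg := by
    intro x
    obtain ⟨x', g, hg, hx'⟩ := mk_surj (Fg x)
    have hxx' : x' = x := by rw [← pt_mk x' g hg, ← hx', hFpt]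
    subst hxx'
    exact ⟨g, hg, hx'⟩
  choose gF hgF hFg using hrepF
  -- local form: near `x`, the evaluation `y ↦ gF y y` agrees with any representative of `Fg x`
  have local_form : ∀ (x : M) (g : M → V) (hg : ∃ U : Set M, IsOpen U ∧ x ∈ U ∧ K U g),
      Fg x = mk x g hg → (fun y ↦ gF y y) =ᶠ[𝓝 x] g := by
    rintro x g ⟨U, hU, hx, hg⟩ hFx
    have hmem : Fg x ∈ sheet U g hU hg U := by
      rw [hFx]
      exact ⟨x, hx, hx, rfl⟩
    have hev : ∀ᶠ y in 𝓝 x, Fg y ∈ sheet U g hU hg U :=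
      Fg.continuous.continuousAt.eventually_mem ((isOpen_sheet U g hU hg hU).mem_nhds hmem)
    filter_upwards [hev] with y hy
    obtain ⟨y', hy', -, hFy⟩ := hy
    have hyy' : y' = y := by rw [← pt_mk y' g ⟨U, hU, hy', hg⟩, ← hFy, hFpt]
    subst hyy'
    have h1 : mk y' (gF y') (hgF y') = mk y' g ⟨U, hU, hy', hg⟩ := (hFg y').symm.trans hFy
    exact (mk_eq_mk_iff.mp h1).2.eq_of_nhds
  refine ⟨fun y ↦ gF y y, ?_, ?_⟩
  · -- `K` everywhere, by locality
    refine hK_local _ fun x ↦ ?_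
    obtain ⟨U, hU, hx, hg⟩ := hgF x
    have hloc := local_form x (gF x) (hgF x) (hFg x)
    obtain ⟨U', hU'sub, hU'o, hxU'⟩ := mem_nhds_iff.mp (Filter.inter_mem hloc (hU.mem_nhds hx))
    refine ⟨U', hU'o, hxU', gF x, hK_mono hg hU'o (fun y hy ↦ (hU'sub hy).2), fun y hy ↦ ?_⟩
    exact (hU'sub hy).1
  · -- agreement with `f₀` on `O`: the set where `Fg` is the germ of `f₀` is open and closed in `O`
    let D : Set M := Fg ⁻¹' sheet O f₀ hO hf₀ O
    have hDo : IsOpen D := (isOpen_sheet O f₀ hO hf₀ hO).preimage Fg.continuous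
    have hx₀D : x₀ ∈ D := by
      show Fg x₀ ∈ sheet O f₀ hO hf₀ O
      rw [hF₀]
      exact ⟨x₀, hx₀, hx₀, rfl⟩
    have hOD : O ⊆ D := by
      refine hOc.isPreconnected.subset_of_closure_inter_subset hDo ⟨x₀, hx₀, hx₀D⟩ ?_
      rintro x ⟨hxc, hxO⟩
      -- a representative of `Fg x` and a connected neighbourhood inside everything
      obtain ⟨U, hU, hxU, hg⟩ := hgF x
      have hloc := local_form x (gF x) (hgF x) (hFg x)
      have hsh : ∀ᶠ y in 𝓝 x, Fg y ∈ sheet U (gF x) hU hg U :=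
        Fg.continuous.continuousAt.eventually_mem ((isOpen_sheet U (gF x) hU hg hU).mem_nhds
          (by rw [hFg x]; exact ⟨x, hxU, hxU, rfl⟩))
      obtain ⟨C, hCsub, hCo, hxC, hCc⟩ := locallyConnectedSpace_iff_subsets_isOpen_isConnected.mp
        inferInstance x _ (Filter.inter_mem (Filter.inter_mem hsh (hU.mem_nhds hxU)) (hO.mem_nhds hxO))
      -- a point of `C` where `Fg` is the germ of `f₀`
      obtain ⟨y, hyC, hyD⟩ : (C ∩ D).Nonempty := by
        rw [mem_closure_iff_nhds] at hxc
        exact hxc C (hCo.mem_nhds hxC) |>.imp fun y hy ↦ ⟨hy.1, hy.2⟩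
      have h1 : Fg y ∈ sheet U (gF x) hU hg U := (hCsub hyC).1.1
      have h2 : Fg y ∈ sheet O f₀ hO hf₀ O := hyD
      rw [hFg y] at h1 h2
      have e1 := ((mk_mem_sheet_iff U (gF x) hU hg U).mp h1).2.2
      have e2 := ((mk_mem_sheet_iff O f₀ hO hf₀ O).mp h2).2.2
      have hev : gF x =ᶠ[𝓝 y] f₀ := e1.symm.trans e2
      have hCU : C ⊆ U := fun z hz ↦ (hCsub hz).1.2
      have hCO : C ⊆ O := fun z hz ↦ (hCsub hz).2
      have hEq : EqOn (gF x) f₀ C :=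
        hK_uniq hCo hCc.isPreconnected (hK_mono hg hCo hCU) (hK_mono hf₀ hCo hCO) hyC hev
      have hevx : gF x =ᶠ[𝓝 x] f₀ := Filter.eventuallyEq_of_mem (hCo.mem_nhds hxC) hEq
      show Fg x ∈ sheet O f₀ hO hf₀ O
      rw [hFg x]
      exact (mk_mem_sheet_iff O f₀ hO hf₀ O).mpr ⟨hxO, hxO, hevx⟩
    intro x hxO
    have hx := hOD hxO
    obtain ⟨x', hx', -, hFx'⟩ := hx
    have hxx' : x' = x := by rw [← pt_mk x' f₀ ⟨O, hO, hx', hf₀⟩, ← hFx', hFpt]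
    subst hxx'
    exact (local_form x' f₀ ⟨O, hO, hx', hf₀⟩ hFx').eq_of_nhds

end Literature.Topology.CoveringSpaces

end
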